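import Literature.Analysis.ODE.JostScattering1D
import Literature.Analysis.ODE.ConjugatePairWronskian
import HarnessLib

/-!
# Stationary scattering on the line at real energy, II: unitarity and the scattering eigenfunctions

Topic `Literature/Analysis/ODE` (namespace `Literature.Analysis.ODE.Scattering1D`), continuation of
`JostScattering1D.lean` (Marchenko, Ch. 3 §5; Deift–Trubowitz §2).  For a Jost pair
`fp ~ e^{iωx}` (`+∞`), `fm ~ e^{−iωx}` (`−∞`) of `−f″ + V f = ω² f`, `ω ≠ 0`, everything PROVED, with
no hypothesis on `V` beyond the existence of the pair (which is assumed, not asserted):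

* `normSq_wronskian_sub_normSq_wronskian_conj` — the Plücker identity
  `‖W(u, e)‖² − ‖W(u, ē)‖² = −4·Im(ū u′)·Im(ē e′)` (pure algebra);
* **unitarity** (Marchenko (3.5.7)): `‖W(f₋, f₊)(0)‖² = 4ω² + ‖W(f₊, f̄₋)(0)‖²`
  (`normSq_wronskian_eq`), `|a|² = 1 + |b|²` (`normSq_jostA_eq`), the Jost pair is fundamental
  (`wronskian_ne_zero`), `‖T‖² + ‖R₋‖² = 1`, `‖R₊‖ = ‖R₋‖`, `‖T‖² + ‖R₊‖² = 1`, `‖T‖, ‖R₊‖ ≤ 1`;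
* **the scattering eigenfunctions** (Marchenko (3.5.4′)/(3.5.8′) and (3.5.4)/(3.5.8)):
  `T f₋ = f̄₊ + R₊ f₊` and `T f₊ = f̄₋ + R₋ f₋` pointwise on `ℝ` together with the derivatives
  (`rightScattering_eq`, `leftScattering_eq`) — so `T f₋ ~ e^{−iωx} + R₊ e^{iωx}` at `+∞` and
  `~ T e^{−iωx}` at `−∞`: `T` transmits, `R₊` reflects a wave incident from the right; proved by the
  constant-amplitude decomposition over the flux-carrying conjugate pair `(f₊, f̄₊)`
  (`ConjugatePair.decomp`, reused);
* **the standing wave at `+∞`** (`tendsto_rightScattering_standingWave`): if `R₊ = |R₊| e^{2iθ}`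
  then `e^{−iθ} T f₋(x) − [(1 + |R₊|) cos(ωx + θ) − i(1 − |R₊|) sin(ωx + θ)] → 0` as `x → +∞` —
  `θ` is the real standing-wave phase of the wave incident from the right.

## References
* V. A. Marchenko, *Sturm–Liouville Operators and Applications*, AMS Chelsea (2011), Ch. 3 §5,
  (3.5.4)–(3.5.9). Key `Marchenko2011`.
* P. Deift, E. Trubowitz, Comm. Pure Appl. Math. 32 (1979) 121–251, §2. Key `DeiftTrubowitz1979`.
-/

noncomputable section

open Set Filter
open scoped Topology ComplexConjugate

namespace Literature.Analysis.ODE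

namespace Scattering1D

open _root_.Complex (I exp)

variable {V : ℝ → ℝ} {ω : ℝ} {fp fp' fm fm' : ℝ → ℂ}

/-! ### Unitarity -/

/-- **The Plücker identity for Wronskians over a conjugate pair** (pure algebra): for complex
numbers `u, u₁, e, e₁`,
`‖u e₁ − u₁ e‖² − ‖u ē₁ − u₁ ē‖² = −4 · Im(ū u₁) · Im(ē e₁)`
(`W(u,e) W(ū,ē) − W(u,ē) W(ū,e) = W(u,ū) W(e,ē)` with `W(u,ū) = −2i Im(ū u₁)`). [folklore] -/
theorem normSq_wronskian_sub_normSq_wronskian_conj (u u₁ e e₁ : ℂ) :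
    ‖u * e₁ - u₁ * e‖ ^ 2 - ‖u * conj e₁ - u₁ * conj e‖ ^ 2 =
      -4 * (conj u * u₁).im * (conj e * e₁).im := by
  simp only [Complex.sq_norm, Complex.normSq_apply, Complex.sub_re, Complex.sub_im, Complex.mul_re,
    Complex.mul_im, Complex.conj_re, Complex.conj_im]
  ring

/-- **Unitarity of the scattering matrix, Wronskian form** (Marchenko (3.5.7) `|a|² = 1 + |b|²`
multiplied by `4ω²`): for a Jost pair at `ω`,
`‖W(f₋, f₊)(0)‖² = 4ω² + ‖W(f₊, f̄₋)(0)‖²`. [cite: Marchenko2011, Ch. 3 §5 (3.5.7)] -/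
theorem normSq_wronskian_eq (hp : IsRightJost V ω fp fp') (hm : IsLeftJost V ω fm fm') :
    ‖wronskian fm fm' fp fp' 0‖ ^ 2 =
      4 * ω ^ 2 + ‖wronskian fp fp' (fun x ↦ conj (fm x)) (fun x ↦ conj (fm' x)) 0‖ ^ 2 := by
  have key := normSq_wronskian_sub_normSq_wronskian_conj (fm 0) (fm' 0) (fp 0) (fp' 0)
  rw [hm.flux_eq 0, hp.flux_eq 0] at key
  have e1 : ‖wronskian fp fp' (fun x ↦ conj (fm x)) (fun x ↦ conj (fm' x)) 0‖ =
      ‖fm 0 * conj (fp' 0) - fm' 0 * conj (fp 0)‖ := by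
    rw [wronskian, ← norm_neg, ← Complex.norm_conj]
    congr 1
    simp only [map_neg, map_sub, map_mul, Complex.conj_conj]
    ring
  rw [e1, wronskian]
  linarith

/-- `|a(ω)|² = 1 + |b(ω)|²` for a Jost pair at `ω ≠ 0`. [cite: Marchenko2011, Ch. 3 §5 (3.5.7)] -/
theorem normSq_jostA_eq (hp : IsRightJost V ω fp fp') (hm : IsLeftJost V ω fm fm') (hω : ω ≠ 0) :
    ‖jostA ω fp fp' fm fm'‖ ^ 2 = 1 + ‖jostB ω fp fp' fm fm'‖ ^ 2 := by
  have hn : ‖2 * (ω : ℂ) * I‖ ^ 2 = 4 * ω ^ 2 := by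
    rw [norm_mul, norm_mul, Complex.norm_I, Complex.norm_real, Complex.norm_two, Real.norm_eq_abs,
      mul_one, mul_pow, sq_abs]
    norm_num
  have h4 : (4 : ℝ) * ω ^ 2 ≠ 0 := mul_ne_zero four_ne_zero (pow_ne_zero 2 hω)
  rw [jostA, jostB, norm_div, norm_div, div_pow, div_pow, hn, normSq_wronskian_eq hp hm]
  field_simp

/-- **The Jost pair is a fundamental system**: `W(f₋, f₊)(0) ≠ 0` (indeed `|W| ≥ 2|ω|`), `ω ≠ 0`.
[cite: Marchenko2011, Ch. 3 §5] -/
theorem wronskian_ne_zero (hp : IsRightJost V ω fp fp') (hm : IsLeftJost V ω fm fm') (hω : ω ≠ 0) :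
    wronskian fm fm' fp fp' 0 ≠ 0 := by
  intro h0
  have key := normSq_wronskian_eq hp hm
  rw [h0, norm_zero] at key
  have : (0 : ℝ) < 4 * ω ^ 2 := by positivity
  nlinarith [norm_nonneg (wronskian fp fp' (fun x ↦ conj (fm x)) (fun x ↦ conj (fm' x)) 0)]

/-- **`|T|² + |R₋|² = 1`.** [cite: Marchenko2011, Ch. 3 §5 (3.5.7), (3.5.9)] -/
theorem normSq_transmissionCoeff_add_normSq_reflectionLeft (hp : IsRightJost V ω fp fp')
    (hm : IsLeftJost V ω fm fm') (hω : ω ≠ 0) :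
    ‖transmissionCoeff ω fp fp' fm fm'‖ ^ 2 + ‖reflectionLeft fp fp' fm fm'‖ ^ 2 = 1 := by
  have hW := wronskian_ne_zero hp hm hω
  have hWn : ‖wronskian fm fm' fp fp' 0‖ ^ 2 ≠ 0 := pow_ne_zero 2 (norm_ne_zero_iff.2 hW)
  have hn : ‖2 * (ω : ℂ) * I‖ ^ 2 = 4 * ω ^ 2 := by
    rw [norm_mul, norm_mul, Complex.norm_I, Complex.norm_real, Complex.norm_two, Real.norm_eq_abs,
      mul_one, mul_pow, sq_abs]
    norm_num
  rw [transmissionCoeff, reflectionLeft, norm_div, norm_div, div_pow, div_pow, hn,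
    ← add_div, div_eq_one_iff_eq hWn, normSq_wronskian_eq hp hm]

/-- **`|R₊| = |R₋|`** (`W(f̄₊, f₋) = conj W(f₊, f̄₋)`). [cite: Marchenko2011, Ch. 3 §5 (3.5.9)] -/
theorem norm_reflectionRight_eq (fp fp' fm fm' : ℝ → ℂ) :
    ‖reflectionRight fp fp' fm fm'‖ = ‖reflectionLeft fp fp' fm fm'‖ := by
  rw [reflectionRight, reflectionLeft, norm_div, norm_div]
  congr 1
  rw [wronskian, wronskian, ← Complex.norm_conj]
  simp only [map_sub, map_mul, Complex.conj_conj]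

/-- **`|T|² + |R₊|² = 1`.** [cite: Marchenko2011, Ch. 3 §5 (3.5.7), (3.5.9)] -/
theorem normSq_transmissionCoeff_add_normSq_reflectionRight (hp : IsRightJost V ω fp fp')
    (hm : IsLeftJost V ω fm fm') (hω : ω ≠ 0) :
    ‖transmissionCoeff ω fp fp' fm fm'‖ ^ 2 + ‖reflectionRight fp fp' fm fm'‖ ^ 2 = 1 := by
  rw [norm_reflectionRight_eq]
  exact normSq_transmissionCoeff_add_normSq_reflectionLeft hp hm hω

/-- In particular `|T| ≤ 1` and `|R₊| ≤ 1`. [cite: Marchenko2011, Ch. 3 §5] -/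
theorem norm_transmissionCoeff_le_one (hp : IsRightJost V ω fp fp') (hm : IsLeftJost V ω fm fm')
    (hω : ω ≠ 0) : ‖transmissionCoeff ω fp fp' fm fm'‖ ≤ 1 ∧ ‖reflectionRight fp fp' fm fm'‖ ≤ 1 := by
  have h := normSq_transmissionCoeff_add_normSq_reflectionRight hp hm hω
  constructor <;> nlinarith [norm_nonneg (transmissionCoeff ω fp fp' fm fm'),
    norm_nonneg (reflectionRight fp fp' fm fm')]

/-! ### The scattering eigenfunctions -/

/-- **The right scattering eigenfunction** `u⁺ = T f₋ = e⁺(−λ,·) + R₊ e⁺(λ,·)`: for a Jost pair at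
`ω ≠ 0` and every `x`, `T·f₋(x) = conj f₊(x) + R₊·f₊(x)` and `T·f₋′(x) = conj f₊′(x) + R₊·f₊′(x)`
(so `T f₋ ~ e^{−iωx} + R₊ e^{iωx}` at `+∞`, `~ T e^{−iωx}` at `−∞`).
[cite: Marchenko2011, Ch. 3 §5 (3.5.4′), (3.5.8′)] -/
theorem rightScattering_eq (hp : IsRightJost V ω fp fp') (hm : IsLeftJost V ω fm fm') (hω : ω ≠ 0)
    (x : ℝ) :
    transmissionCoeff ω fp fp' fm fm' * fm x = conj (fp x) + reflectionRight fp fp' fm fm' * fp x ∧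
      transmissionCoeff ω fp fp' fm fm' * fm' x =
        conj (fp' x) + reflectionRight fp fp' fm fm' * fp' x := by
  have hW0 := wronskian_ne_zero hp hm hω
  simp only [transmissionCoeff, reflectionRight]
  set α : ℝ := min x 0 with hα
  have hxI : x ∈ Icc α (max x 0) := ⟨min_le_left _ _, le_max_left _ _⟩
  have hu := hasDerivAt_pair_of_isSol2 hm.isSol2 α (max x 0)
  have he := hasDerivAt_pair_of_isSol2 hp.isSol2 α (max x 0)
  have hflux : (conj (fp α) * fp' α).im = ω := hp.flux_eq α
  have hf : (conj (fp α) * fp' α).im ≠ 0 := by rw [hflux]; exact hω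
  obtain ⟨h0, h1⟩ := ConjugatePair.decomp hu he hf hxI
  have hD : fp α * conj (fp' α) - fp' α * conj (fp α) = -(2 * (ω : ℂ)) * I := by
    rw [ConjugatePair.wronskian_self_conj, hflux]
  have hW : fm' α * fp α - fm α * fp' α = -wronskian fm fm' fp fp' 0 := by
    rw [← wronskian_eq_wronskian_zero hm.isSol2 hp.isSol2 α, wronskian]
    ring
  have hWc : fm α * conj (fp' α) - fm' α * conj (fp α) =
      -wronskian (fun y ↦ conj (fp y)) (fun y ↦ conj (fp' y)) fm fm' 0 := by
    rw [← wronskian_eq_wronskian_zero (isSol2_conj hp.isSol2) hm.isSol2 α, wronskian]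
    ring
  rw [hD, hW, hWc] at h0 h1
  have hω' : (ω : ℂ) ≠ 0 := Complex.ofReal_ne_zero.2 hω
  have hI : I ≠ 0 := Complex.I_ne_zero
  constructor
  · rw [h0]
    field_simp
    ring
  · rw [h1]
    field_simp
    ring

/-- **The left scattering eigenfunction** `u⁻ = T f₊ = e⁻(λ,·) + R₋ e⁻(−λ,·)`: for a Jost pair at
`ω ≠ 0` and every `x`, `T·f₊(x) = conj f₋(x) + R₋·f₋(x)` and `T·f₊′(x) = conj f₋′(x) + R₋·f₋′(x)`
(so `T f₊ ~ e^{iωx} + R₋ e^{−iωx}` at `−∞`, `~ T e^{iωx}` at `+∞`).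
[cite: Marchenko2011, Ch. 3 §5 (3.5.4), (3.5.8)] -/
theorem leftScattering_eq (hp : IsRightJost V ω fp fp') (hm : IsLeftJost V ω fm fm') (hω : ω ≠ 0)
    (x : ℝ) :
    transmissionCoeff ω fp fp' fm fm' * fp x = conj (fm x) + reflectionLeft fp fp' fm fm' * fm x ∧
      transmissionCoeff ω fp fp' fm fm' * fp' x =
        conj (fm' x) + reflectionLeft fp fp' fm fm' * fm' x := by
  have hW0 := wronskian_ne_zero hp hm hω
  simp only [transmissionCoeff, reflectionLeft]
  set α : ℝ := min x 0 with hα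
  have hxI : x ∈ Icc α (max x 0) := ⟨min_le_left _ _, le_max_left _ _⟩
  have hu := hasDerivAt_pair_of_isSol2 hp.isSol2 α (max x 0)
  have he := hasDerivAt_pair_of_isSol2 hm.isSol2 α (max x 0)
  have hflux : (conj (fm α) * fm' α).im = -ω := hm.flux_eq α
  have hf : (conj (fm α) * fm' α).im ≠ 0 := by rw [hflux]; exact neg_ne_zero.2 hω
  obtain ⟨h0, h1⟩ := ConjugatePair.decomp hu he hf hxI
  have hD : fm α * conj (fm' α) - fm' α * conj (fm α) = -(2 * ((-ω : ℝ) : ℂ)) * I := by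
    rw [ConjugatePair.wronskian_self_conj, hflux]
  have hW : fp' α * fm α - fp α * fm' α = wronskian fm fm' fp fp' 0 := by
    rw [← wronskian_eq_wronskian_zero hm.isSol2 hp.isSol2 α, wronskian]
    ring
  have hWc : fp α * conj (fm' α) - fp' α * conj (fm α) =
      wronskian fp fp' (fun y ↦ conj (fm y)) (fun y ↦ conj (fm' y)) 0 := by
    rw [← wronskian_eq_wronskian_zero hp.isSol2 (isSol2_conj hm.isSol2) α, wronskian]
  rw [hD, hW, hWc] at h0 h1
  have hω' : (ω : ℂ) ≠ 0 := Complex.ofReal_ne_zero.2 hω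
  have hI : I ≠ 0 := Complex.I_ne_zero
  push_cast at h0 h1
  constructor
  · rw [h0]
    field_simp
    ring
  · rw [h1]
    field_simp
    ring

/-! ### The free case -/

/-- The derivative of `x ↦ e^{i s ω x}`-type exponentials: `d/dx e^{c·x} = c e^{c·x}` for the linear
phase `x ↦ (ω x) i`. [folklore] -/
theorem hasDerivAt_exp_phase (ω x : ℝ) :
    HasDerivAt (fun y : ℝ ↦ exp (((ω * y : ℝ) : ℂ) * I)) ((ω : ℂ) * I * exp (((ω * x : ℝ) : ℂ) * I)) x := by
  have h : HasDerivAt (fun y : ℝ ↦ ((ω * y : ℝ) : ℂ) * I) ((ω : ℂ) * I) x := by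
    have h1 : HasDerivAt (fun y : ℝ ↦ ((y : ℝ) : ℂ)) 1 x := Complex.ofRealCLM.hasDerivAt
    have h2 := (h1.const_mul (ω : ℂ)).mul_const I
    refine h2.congr_of_eventuallyEq ?_ |>.congr_deriv (by ring)
    exact Eventually.of_forall fun y ↦ by push_cast; ring
  exact (h.cexp).congr_deriv (by ring)

/-- **The free right Jost solution**: for `V = 0`, `(e^{iωx}, iω e^{iωx})` is a right Jost pair at
`ω`. [cite: Marchenko2011, Ch. 3 §5] -/
theorem isRightJost_free (ω : ℝ) : IsRightJost (fun _ ↦ 0) ω (fun x ↦ exp (((ω * x : ℝ) : ℂ) * I))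
    (fun x ↦ (ω : ℂ) * I * exp (((ω * x : ℝ) : ℂ) * I)) where
  isSol2 := by
    refine ⟨fun x _ ↦ hasDerivAt_exp_phase ω x, fun x _ ↦ ?_⟩
    refine ((hasDerivAt_exp_phase ω x).const_mul ((ω : ℂ) * I)).congr_deriv ?_
    have hI : I * I = -1 := Complex.I_mul_I
    have e : (((ω * x : ℝ) : ℂ) * I) = (ω : ℂ) * (x : ℂ) * I := by push_cast; ring
    rw [e]
    push_cast
    linear_combination ((ω : ℂ) * (ω : ℂ) * exp ((ω : ℂ) * (x : ℂ) * I)) * hI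
  tendsto := by
    refine tendsto_const_nhds.congr fun x ↦ ?_
    rw [← Complex.exp_add]
    simp
  tendsto_deriv := by
    refine tendsto_const_nhds.congr fun x ↦ ?_
    rw [mul_comm ((ω : ℂ) * I), ← mul_assoc, ← Complex.exp_add]
    simp

/-- **The free left Jost solution**: for `V = 0`, `(e^{−iωx}, −iω e^{−iωx})` is a left Jost pair at
`ω` (it is the free right pair at `−ω`). [cite: Marchenko2011, Ch. 3 §5] -/
theorem isLeftJost_free (ω : ℝ) : IsLeftJost (fun _ ↦ 0) ω (fun x ↦ exp (-((ω * x : ℝ) : ℂ) * I))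
    (fun x ↦ -((ω : ℂ) * I) * exp (-((ω * x : ℝ) : ℂ) * I)) where
  isSol2 := by
    have h := (isRightJost_free (-ω)).isSol2
    refine ⟨fun x _ ↦ ?_, fun x _ ↦ ?_⟩
    · have h1 := h.hasDerivAt x (mem_univ x)
      simp only [neg_mul, Complex.ofReal_neg, Complex.ofReal_mul] at h1 ⊢
      convert h1 using 2
    · have h1 := h.hasDerivAt_deriv x (mem_univ x)
      simp only [neg_mul, Complex.ofReal_neg, Complex.ofReal_mul, even_two.neg_pow] at h1 ⊢
      convert h1 using 2
  tendsto := by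
    refine tendsto_const_nhds.congr fun x ↦ ?_
    rw [← Complex.exp_add]
    simp
  tendsto_deriv := by
    refine tendsto_const_nhds.congr fun x ↦ ?_
    rw [mul_comm (-((ω : ℂ) * I)), ← mul_assoc, ← Complex.exp_add]
    simp

/-- In the free case `T = 1` and `R₊ = 0` (`ω ≠ 0`). [cite: Marchenko2011, Ch. 3 §5] -/
theorem transmissionCoeff_free {ω : ℝ} (hω : ω ≠ 0) :
    transmissionCoeff ω (fun x ↦ exp (((ω * x : ℝ) : ℂ) * I))
        (fun x ↦ (ω : ℂ) * I * exp (((ω * x : ℝ) : ℂ) * I)) (fun x ↦ exp (-((ω * x : ℝ) : ℂ) * I))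
        (fun x ↦ -((ω : ℂ) * I) * exp (-((ω * x : ℝ) : ℂ) * I)) = 1 ∧
      reflectionRight (fun x ↦ exp (((ω * x : ℝ) : ℂ) * I))
        (fun x ↦ (ω : ℂ) * I * exp (((ω * x : ℝ) : ℂ) * I)) (fun x ↦ exp (-((ω * x : ℝ) : ℂ) * I))
        (fun x ↦ -((ω : ℂ) * I) * exp (-((ω * x : ℝ) : ℂ) * I)) = 0 := by
  have hω' : (ω : ℂ) ≠ 0 := Complex.ofReal_ne_zero.2 hω
  constructor
  · simp only [transmissionCoeff, wronskian]
    simp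
    field_simp
    ring
  · simp only [reflectionRight, wronskian]
    simp

/-! ### Jost families -/

namespace JostFamily

variable (J : JostFamily V)

/-- **`|T(ω)|² + |R₊(ω)|² = 1`** for a Jost family, `ω > 0`. [cite: Marchenko2011, Ch. 3 §5 (3.5.7)] -/
theorem normSq_T_add_normSq_Rright {ω : ℝ} (hω : 0 < ω) : ‖J.T ω‖ ^ 2 + ‖J.Rright ω‖ ^ 2 = 1 :=
  normSq_transmissionCoeff_add_normSq_reflectionRight (J.isRightJost ω hω) (J.isLeftJost ω hω) hω.ne'

/-- **`|T(ω)|² + |R₋(ω)|² = 1`** for a Jost family, `ω > 0`. [cite: Marchenko2011, Ch. 3 §5 (3.5.7)] -/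
theorem normSq_T_add_normSq_Rleft {ω : ℝ} (hω : 0 < ω) : ‖J.T ω‖ ^ 2 + ‖J.Rleft ω‖ ^ 2 = 1 :=
  normSq_transmissionCoeff_add_normSq_reflectionLeft (J.isRightJost ω hω) (J.isLeftJost ω hω) hω.ne'

/-- `|R₊(ω)| = |R₋(ω)|`. [cite: Marchenko2011, Ch. 3 §5 (3.5.9)] -/
theorem norm_Rright_eq (ω : ℝ) : ‖J.Rright ω‖ = ‖J.Rleft ω‖ :=
  norm_reflectionRight_eq _ _ _ _

/-- The right scattering eigenfunction of a family: `T f₋ = conj f₊ + R₊ f₊` at `ω > 0`.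
[cite: Marchenko2011, Ch. 3 §5 (3.5.8′)] -/
theorem T_mul_fm {ω : ℝ} (hω : 0 < ω) (x : ℝ) :
    J.T ω * J.fm ω x = conj (J.fp ω x) + J.Rright ω * J.fp ω x :=
  (rightScattering_eq (J.isRightJost ω hω) (J.isLeftJost ω hω) hω.ne' x).1

end JostFamily

/-! ### The standing wave at `+∞` -/

/-- **The right scattering eigenfunction is asymptotically a standing wave**: for a Jost pair at
`ω ≠ 0` and a reflection phase `θ` of `R₊` (`R₊ = |R₊| e^{2iθ}`),
`e^{−iθ} T f₋(x) − [(1 + |R₊|) cos(ωx + θ) − i (1 − |R₊|) sin(ωx + θ)] → 0` as `x → +∞`; in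
particular `Re(e^{−iθ} T f₋)(x) = (1 + |R₊|) cos(ωx + θ) + o(1)` — `θ` is the REAL standing-wave
phase of the wave incident from the right (total reflection `|R₊| = 1`: `e^{−iθ} T f₋ − 2cos(ωx + θ) → 0`).
[cite: Marchenko2011, Ch. 3 §5 (3.5.8′)] -/
theorem tendsto_rightScattering_standingWave (hp : IsRightJost V ω fp fp')
    (hm : IsLeftJost V ω fm fm') (hω : ω ≠ 0) {θ : ℝ}
    (hθ : IsReflectionPhase (reflectionRight fp fp' fm fm') θ) :
    Tendsto (fun x : ℝ ↦ exp (-(θ : ℂ) * I) * (transmissionCoeff ω fp fp' fm fm' * fm x) -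
      ((1 + ‖reflectionRight fp fp' fm fm'‖ : ℂ) * Complex.cos ((ω * x + θ : ℝ) : ℂ) -
        (1 - ‖reflectionRight fp fp' fm fm'‖ : ℂ) * Complex.sin ((ω * x + θ : ℝ) : ℂ) * I))
      atTop (𝓝 0) := by
  set R := reflectionRight fp fp' fm fm' with hR
  -- the normalised amplitude `m(x) = e^{−iωx} f₊(x)` tends to `1`
  have hm1 : Tendsto (fun x : ℝ ↦ exp (-((ω * x : ℝ) : ℂ) * I) * fp x - 1) atTop (𝓝 0) := by
    simpa using hp.tendsto.sub_const 1
  have hbound : Tendsto (fun x : ℝ ↦ (1 + ‖R‖) * ‖exp (-((ω * x : ℝ) : ℂ) * I) * fp x - 1‖)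
      atTop (𝓝 0) := by
    simpa using (tendsto_zero_iff_norm_tendsto_zero.1 hm1).const_mul (1 + ‖R‖)
  refine squeeze_zero_norm (fun x ↦ ?_) hbound
  have hsc := (rightScattering_eq hp hm hω x).1
  rw [← hR] at hsc
  have hsw := hθ.standingWave ω x
  have hnt : ‖exp (-(θ : ℂ) * I)‖ = 1 := by
    have : (-(θ : ℂ) * I) = ((-θ : ℝ) : ℂ) * I := by push_cast; ring
    rw [this]
    exact Complex.norm_exp_ofReal_mul_I _
  set s : ℂ := ((ω * x : ℝ) : ℂ) with hs
  have hee : exp (s * I) * exp (-s * I) = 1 := by rw [← Complex.exp_add]; simp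
  have hns : ‖exp (s * I)‖ = 1 := by rw [hs]; exact Complex.norm_exp_ofReal_mul_I _
  have e0 : exp (s * I) * (exp (-s * I) * fp x - 1) = fp x - exp (s * I) := by
    rw [mul_sub, ← mul_assoc, hee, one_mul, mul_one]
  have e1 : conj (exp (s * I) * (exp (-s * I) * fp x - 1)) = conj (fp x) - exp (-s * I) := by
    rw [e0, map_sub, hs, conj_exp_ofReal_mul_I]
  have n1 : ‖fp x - exp (s * I)‖ = ‖exp (-s * I) * fp x - 1‖ := by
    rw [← e0, norm_mul, hns, one_mul]
  have n2 : ‖conj (fp x) - exp (-s * I)‖ = ‖exp (-s * I) * fp x - 1‖ := by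
    rw [← e1, Complex.norm_conj, norm_mul, hns, one_mul]
  have key : exp (-(θ : ℂ) * I) * (transmissionCoeff ω fp fp' fm fm' * fm x) -
      ((1 + ‖R‖ : ℂ) * Complex.cos ((ω * x + θ : ℝ) : ℂ) -
        (1 - ‖R‖ : ℂ) * Complex.sin ((ω * x + θ : ℝ) : ℂ) * I) =
      exp (-(θ : ℂ) * I) * ((conj (fp x) - exp (-s * I)) + R * (fp x - exp (s * I))) := by
    rw [hsc, ← hsw]
    ring
  rw [key, norm_mul, hnt, one_mul]
  calc ‖conj (fp x) - exp (-s * I) + R * (fp x - exp (s * I))‖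
      ≤ ‖conj (fp x) - exp (-s * I)‖ + ‖R * (fp x - exp (s * I))‖ := norm_add_le _ _
    _ = (1 + ‖R‖) * ‖exp (-s * I) * fp x - 1‖ := by rw [norm_mul, n1, n2]; ring

end Scattering1D

end Literature.Analysis.ODE
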